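import Literature.AnabelianGeometry.EtaleTheta.Thm56SubdagStatements

/-!
# [EtTh] Prop. 5.5 — the print-faithful (varying-codomain) form of the transport and of uniqueness (PDF p.102 = printed p.328)

Mochizuki, *The étale theta function …*, Publ. RIMS **45** (2009)
[cite: MochizukiEtTh2009, Prop 5.5 proof p.328 (PDF p.102)].  abc-iut cell, layer L2, sequel of §K row K4 (seat
abc-iut-w5-d020 gen 2; plan/L2/SUBDAG-EtTh-Thm56.md rows P55-L04/L05/L06) after abc-iut-L2-lead's ruling F-w5d123-3
(2026-08-26T03:32Z): print transports the isomorphism of Prop. 5.5 to a theta-saturated `S` «by means of linear morphisms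
`S″ → S`, `S″ → S‴`» from VARYING `l·N`-codomains `S″` (p.328 l.2–11), whereas abc-iut-L2-t4's `LinearlyReachableFromBN`
(and hence the uniqueness clause of its `CyclotomicRigidity`, pinned at `B_N` only — finding F-w5d020-1) fixes the source
`B_N`.  STATEMENTS-FIRST, ADDITIVE (t4's decls untouched; they are the special case «`IsCod = {B_N}`»): over an
admissible-source class `IsCod : C → Prop` (the `l·N`-codomains of `l·N`-th roots of right fraction-pairs of `Θ̈`, Prop.
5.2 (i) — a PARAMETER, as in abc-iut-w5-d123's `FrobenioidCyclotomicRigidity.ReachableFromCodomains`, p420111):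
* `NativeIsoFamily IsCod` — «the resulting Kummer class … determines an isomorphism `(l·Δ_Θ)_{S″} ⊗ ℤ/Nℤ ⥲ μ_N(S″)`»
  at EVERY codomain (p.327 l.−3 – p.328 l.2, «manifestly "functorial"»): the data `ν_{S″}`;
* `IsKummerDeterminedCod` — a candidate family agrees with the native isomorphism at every codomain;
* `TransportIndependentCod ν` — «independent of the choice of `S″`, `S‴` and the linear morphisms» (p.328 l.8–11), graph
  form with two sources;
* `BijectivelyReachableFromCodomains IsCod` — d123's `ReachableFromCodomains` with «induce isomorphisms»;
* `CyclotomicRigidityCod` — Prop. 5.5 in this currency: existence of a functorial family Kummer-determined at every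
  codomain, and uniqueness among such.
The derivations (existence from reach + independence + the transport laws; uniqueness from reach alone; bijectivity
from Def. 5.4) are in the proof-only companion `Thm56SubdagCodomainsProofs.lean`.
HONEST FRAMING: predicates on the §5 data, nothing asserted; typed ≠ proved; no side taken on [IUTchIII] Cor. 3.12.
-/

namespace Literature.AnabelianGeometry.EtaleTheta

open CategoryTheory
open FrobenioidCyclotomicRigidity

universe w v v' u u'

namespace ThetaFrobenioid

namespace Thm56Sub

variable {C : Type u} [Category.{v} C] {D : Type u'} [Category.{v'} D] (𝔉 : ThetaFrobenioid.{w} C D)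

/-- **EtTh:Prop5.5/P55-L01+L04 (varying codomains)** (p.327 l.−6 – p.328 l.2: at every `l·N`-codomain `S″` «the
resulting Kummer class … determines an isomorphism `(l·Δ_Θ)_{S″} ⊗ ℤ/Nℤ ⥲ μ_N(S″)`, which is manifestly "functorial"»):
the DATA of a native isomorphism at every member of the admissible-source class `IsCod`.
[cite: MochizukiEtTh2009, Prop 5.5 proof p.327 (PDF p.101)] -/
abbrev NativeIsoFamily (IsCod : C → Prop) : Type (max u v w) :=
  ∀ S'' : C, IsCod S'' → (𝔉.lDeltaModN S'' ≃* 𝔉.muTorsion S'' 𝔉.N)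

/-- A candidate rigidity family is **Kummer-determined at every codomain**: it agrees there with the native isomorphism
(print-faithful replacement of "Kummer-determined at `B_N`", finding F-w5d020-1).
[cite: MochizukiEtTh2009, Prop 5.5 proof p.328 (PDF p.102)] -/
def IsKummerDeterminedCod {IsCod : C → Prop} (hcodSat : ∀ S'', IsCod S'' → 𝔉.IsThetaSaturated S'')
    (ν : NativeIsoFamily 𝔉 IsCod) (ρ : RigidityFamily 𝔉) : Prop :=
  ∀ (S'' : C) (hc : IsCod S'') (x : 𝔉.lDeltaModN S''), ρ S'' (hcodSat S'' hc) x = ν S'' hc x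

/-- **EtTh:Prop5.5/P55-L06 (varying codomains)** (p.328 (PDF p.102) l.8–11: «independent of the choice of `S″`, `S‴` and
the linear morphisms `S″ → S`, `S″ → S‴` [precisely because of the original "functoriality" of the isomorphism for
`S″`]»), INVERSE-FREE graph form with TWO admissible sources: for a theta-saturated `T` and linear `φ : S₁ → T`,
`φ′ : S₂ → T` from codomains, the relations «`y = Δ-push(φ)(x)` and `μ-pull(φ)(u) = ν_{S₁}(x)`» and the same for
`(S₂, φ′)` are compatible.  [cite: MochizukiEtTh2009, Prop 5.5 proof p.328 (PDF p.102)] -/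
def TransportIndependentCod {IsCod : C → Prop} (ν : NativeIsoFamily 𝔉 IsCod) : Prop :=
  ∀ (T : C), 𝔉.IsThetaSaturated T → ∀ (S₁ S₂ : C) (h₁ : IsCod S₁) (h₂ : IsCod S₂) (φ : S₁ ⟶ T) (φ' : S₂ ⟶ T),
    𝔉.IsLinear φ → 𝔉.IsLinear φ' →
    ∀ (x : 𝔉.lDeltaModN S₁) (x' : 𝔉.lDeltaModN S₂) (u : 𝔉.muTorsion T 𝔉.N),
      𝔉.lDeltaModNMap φ x = 𝔉.lDeltaModNMap φ' x' →
        𝔉.muTorsionPull φ 𝔉.N u = ν S₁ h₁ x → 𝔉.muTorsionPull φ' 𝔉.N u = ν S₂ h₂ x'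

/-- **EtTh:Prop5.5/P55-L05 (varying codomains, with «induce isomorphisms»)**: every theta-saturated `S` receives a linear
morphism from SOME admissible codomain inducing BIJECTIONS on `(l·Δ_Θ) ⊗ ℤ/Nℤ` and on `μ_N` (abc-iut-w5-d123's
`ReachableFromCodomains` upgraded by the cardinality count of Def. 5.4 — companion file).
[cite: MochizukiEtTh2009, Prop 5.5 proof p.328 (PDF p.102)] -/
def BijectivelyReachableFromCodomains (IsCod : C → Prop) : Prop :=
  ∀ S : C, 𝔉.IsThetaSaturated S → ∃ (S'' : C) (_ : IsCod S'') (φ : S'' ⟶ S), 𝔉.IsLinear φ ∧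
    Function.Bijective (𝔉.lDeltaModNMap φ) ∧ Function.Bijective (𝔉.muTorsionPull φ 𝔉.N)

/-- **[EtTh] Proposition 5.5 in the varying-codomain currency** (p.327 (PDF p.101): «determines an isomorphism … for all
`(l, N)`-theta-saturated `S ∈ Ob(C)`. This isomorphism is functorial with respect to … the linear morphisms of
`(l, N)`-theta-saturated objects»): there is a rigidity family that is Kummer-determined AT EVERY CODOMAIN and functorial for
linear morphisms, and it is unique among such.  abc-iut-L2-t4's `CyclotomicRigidity P hB` is the special case in which the
class of sources is `{B_N}` and "Kummer-determined" is read through `P` (its `IsKummerDetermined`).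
[cite: MochizukiEtTh2009, Prop 5.5 p.327 (PDF p.101)] -/
def CyclotomicRigidityCod {IsCod : C → Prop} (hcodSat : ∀ S'', IsCod S'' → 𝔉.IsThetaSaturated S'')
    (ν : NativeIsoFamily 𝔉 IsCod) : Prop :=
  (∃ ρ : RigidityFamily 𝔉, IsKummerDeterminedCod 𝔉 hcodSat ν ρ ∧ IsFunctorialLinear 𝔉 ρ) ∧
    ∀ ρ ρ' : RigidityFamily 𝔉, IsKummerDeterminedCod 𝔉 hcodSat ν ρ → IsFunctorialLinear 𝔉 ρ →
      IsKummerDeterminedCod 𝔉 hcodSat ν ρ' → IsFunctorialLinear 𝔉 ρ' → ρ = ρ'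

end Thm56Sub

end ThetaFrobenioid

end Literature.AnabelianGeometry.EtaleTheta
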